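import Mathlib
import HarnessLib
import HarnessLib.Audit
import Summits.NavierStokesRegularity.Statement
import Literature.Analysis.FluidPDE.TaoAveragedEuler
import Literature.Analysis.FluidPDE.ClassicalSolution
import Literature.Analysis.FluidPDE.LerayHopf
import Literature.Analysis.FluidPDE.SuitableWeak
import Summits.NavierStokesRegularity.NavierStokesRegularity.Theorems.TypeICertificateLadderNoBlowupToClay
import HarnessLib.Audit.Status.Attr

/-!
Route: OddMorawetz

CLOSED (refuted) 2026-08-17T16:50:10Z by planner-rfix-NavierStokesRegularity-OddMoraw-9e6ccff7-0 — reason: refuted:stmt-NavierStokesRegularity-1376 (OddMorawetzLocal) by Summit.NavierStokesRegularity.NavierStokesRegularity.Theorems.not_OddMorawetzLocal — note: not_OddMorawetzLocal (Theorems/OddMorawetzOddMorawetzLocalRefutation.lean @6d59d52ab46c; axioms propext/Classical.choice/Quot.sound); substantive: the crux #2 hunt is decided NEGATIVELY for every admissible weight (parity kills even k, weight 1 is a null Lagrangian, k=3 live class R=∫ω·Sω takes both. The file is kept as the record of this route; refuted decls are indexed as negative knowledge (`ledger negatives`).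

Route OddMorawetz — NavierStokesRegularity (Clay A), positive side; realises idea card
morawetz-hunt-odd-virial.

THESIS X. It suffices to show TypeIExclusion ∧ NoTypeII; this route's own content is TypeIExclusion,
won from an ODD
MORAWETZ (virial-type) FUNCTIONAL for 3-D Euler. The even/coercive Lyapunov programme (route
MonotoneCritical, card
no-strict-even-lyapunov) is blocked by time reversal: an even M has an odd Euler derivative, so it
is signed only if it
vanishes. The one parity that time reversal spares is the odd one — exactly the parity of the
free-particle virial
G = Σ x·v (Ġ = Σ|v|² ≥ 0; in tree: Literature.Barriers.AtomisticToContinuum virial_freeFlight /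
virial_flipVel) and of
every Morawetz / interaction-Morawetz functional of dispersive PDE (LinStrauss1978,
CollianderEtAl2004; the only fluid
instance in print is for water waves, AlazardIfrimTataru2020). So ask Euler for its virial:

  OddMorawetzLocal (crux, rank 2): there are k ≤ 5 and a smooth density m on 3-jets such that
  M(u) = ∫ m(u, ∇u, ∇²u, ∇³u) dx is bi-homogeneous of degree (3, k) under u ↦ μ·u(s·) on
divergence-free Schwartz
  fields, and its Euler derivative Q_M(u) := −⟨M′(u), B(u,u)⟩ = −∫ Dm(Ju)[J B(u,u)] dx (B = the
Leray-projected
  nonlinearity Literature.Analysis.FluidPDE.eulerBilinear, pressure included) satisfies Q_M ≥ 0 on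
all
  divergence-free Schwartz fields and Q_M(u₀) > 0 for one of them.

This is a finite-dimensional, order-by-order DECIDABLE question (isotropic cubic densities of
derivative order k = 3, 5
modulo null Lagrangians; positivity of a quartic form with the explicit pressure symbol = an SOS/SDP
feasibility
problem, ChernyshenkoEtAl2014 / FantuzziGoluskin2020 technology), and either answer is a theorem: a
certificate, or
"3-D Euler has no local Morawetz functional of order ≤ 5" (the odd half of the Lyapunov no-go;
negative knowledge the
MonotoneCritical construction crux needs).

  MorawetzKillsTypeI (crux, rank 3): any such certificate excludes Type-I blow-up of finite-energy
classical
  solutions from Schwartz-class data (similarity variables: M scale-covariant, Q_M one-signed along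
the Type-I
  ancient/zoom-in object; KNSS2009, SereginSverak2009, AlbrittonBarker2019).

Lean, Target (= TypeIExclusion, elaborates):
  ∀ (ν T : ℝ), 0 < ν → 0 < T → ∀ u p, Literature.Analysis.FluidPDE.IsClassicalNSSolutionOn (Set.Ico
0 T) ν 0 u p →
    Literature.Analysis.FluidPDE.IsLerayHopfOn T ν 0 (u 0) u →
Literature.Analysis.FluidPDE.HasRapidSpatialDecay (u 0) →
    Literature.Analysis.FluidPDE.IsTypeIBlowup u T →
Literature.Analysis.FluidPDE.HasSmoothExtensionPast ν 0 u T
Assembly (pure logic, checked rc0 in the planner's Sketch.lean):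
  OddMorawetzLocal → MorawetzKillsTypeI → NoTypeII (shared item, TypeILiouville #2) →
  (NoBlowup → NavierStokesRegularity, shared assembly glue of
TypeILiouville/MonotoneCritical/VorticityGeometry) →
  NavierStokesRegularity.

Rationale: WHY THIS LINE. Imported area: dispersive PDE (Morawetz/virial monotonicity, LinStrauss1978,
CollianderEtAl2004,
AlazardIfrimTataru2020) with an explicit dictionary — free flight ↦ Euler, virial Σx·v ↦ odd cubic
local density,
Ġ = Σ|v|² ≥ 0 ↦ Q_M = −⟨M′,B(u,u)⟩ ≥ 0, time reversal v ↦ −v ↦ u(t) ↦ −u(−t) (both flows commute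
with it; odd
functionals are the parity it spares) — plus certified computation (SOS/SDP over quartic
differential forms with the
pressure symbol, ChernyshenkoEtAl2014, FantuzziGoluskin2020) to DECIDE existence order by order.
Consumer: the
Type-I/Liouville programme (KNSS2009, SereginSverak2009, AlbrittonBarker2019,
ChaeWolf2017RemovingDSS) where every
unconditional rung is perturbative or symmetry-bound; a one-signed scale-covariant functional would
be the first
non-perturbative, symmetry-free handle on Type-I ancient objects. Parity bookkeeping (planner,
checked by hand): even M
⇒ Q_M odd ⇒ signed only if ≡ 0; pseudoscalar densities likewise (reflections); so true-scalar cubic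
densities with odd
derivative order k = 3, 5 exhaust the local hunt, WLOG isotropic and bi-homogeneous (rotation
average; Newton-polygon
scaling in (μ, s)). Order 3 reduces to span{R = ∫ω·Sω, J = ∫tr((∇u)²(∇u)ᵀ)} (Betchov; filed as
support
OrderThreeIndefinite, expected negative); order 5 is the real SDP.
RANKED CRUXES. #2 OddMorawetzLocal (the hunt; hardest-and-cheapest-to-decide, most informative
either way).
#3 MorawetzKillsTypeI (the bridge certificate ⇒ Type-I exclusion; stated in ∀-form so it is
logically
(∃ certificate) → Target and is vacuously closed by a negative hunt). #4 NoTypeII (shared with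
TypeILiouville #2;
load-bearing for any Type-I line). Support: NoBlowupToClay (shared glue, stmt-0055), OddNoGoNS (odd
half of the
Lyapunov no-go: an NS-monotone cubic local functional is heat-neutral — provable now by amplitude
scaling),
OrderThreeIndefinite (first run of the hunt). Assembly = #2 → #3 → #4 → NoBlowupToClay →
NavierStokesRegularity,
pure logic (maximal solution ⇒ Type I by #4 ⇒ extends by #2+#3, contradiction).
KILL CRITERIA. (i) ¬OddMorawetzLocal (SDP infeasibility certificates at k = 3 and k = 5, with
rational duals /
explicit Schwartz test fields) refutes #2: close the route `refuted`, record "no local odd Morawetz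
functional of
order ≤ 5 for 3-D Euler" as negative knowledge (it completes the parity classification begun by
no-strict-even-lyapunov). (ii) A refuter showing that for EVERY admissible (k, m) the zero set {Q_M
= 0} contains a
nontrivial scale-invariant family invariant under NS (e.g. all 2-D or all Beltrami fields)
downgrades #3 to "needs a
second functional" — restate or close `exhausted`. (iii) Any Type II blow-up from Schwartz data
kills #4 and Clay (A).
HONEST GAP (planner's own check of the card's H4): a sign alone does not give the card's "large-C
Liouville": on
Type-I(C) profiles the viscous term ν⟨M′,ΔU⟩ is of the same order as Q_M at the intrinsic length 1/C
for every C, so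
#3 needs either quantitative domination ν|⟨M′,Δu⟩| ≤ (1−δ)Q_M on Type-I ancient profiles or rigidity
of {Q_M = 0};
this is why #3 is a crux and not support.
NOT DECOMPOSED YET. The bilocal/interaction class ∫∫K(x−y)a(u)(x)b(u)(y) and x-weighted virials
∫(x/|x|·u)|u|² (next
restate of #2 if the local class dies); Euler-level consequences (sign conditions M(V) ≤ 0 on
self-similar/DSS Euler
profiles, Chae2007/ChaeWolf2020EulerTypeI consumers); how #3 localises M on non-decaying ancient
profiles; the class
bookkeeping L∞-rate ↔ A+C+D+E (AlbrittonBarker2019) inside #3; fact hypotheses for the shared glue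
stmt-0055
(refuters' standing request to the TypeILiouville tenure planner).
NOVELTY (searched 2026-08-15: zbMATH "Morawetz estimate incompressible Euler" → only
AlazardIfrimTataru2020
(doi:10.1007/s42286-020-00044-8) + AJM arXiv:1806.08443, water waves; zbMATH "virial identity
incompressible Euler
monotone" → 0; zbMATH "Goluskin Fantuzzi auxiliary functions" → FantuzziGoluskin2020
(doi:10.1137/19m1277953);
"enstrophy production pressure Hessian" → Lüthi–Holzner–Tsinober JFM 641 (Q–R statistics, no sign
theorem);
Cheviakov–Oberlack doi:10.1017/jfm.2014.611 classify CONSERVED local densities only; lit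
frontier/bridges: nothing on
Morawetz for bulk Euler; in-tree virial only for free flight / Kerr). Delta: parity split of the
Lyapunov question +
SOS classification of odd local cubic densities by the sign of their exact Euler derivative, aimed
at Type-I
exclusion; card graded new-combination by the novelty audit.
BARRIERS. technique_class: odd-morawetz-functional sos-local-densities type-I-bridge.
TaoAveragedBlowup / TruncatedDyadicTypeIBlowup / EnergySupercriticality: a certificate Q_M ≥ 0 is an
algebraic
identity for the EXACT Euler symbol with pressure; averaging B ↦ B̃ changes the quartic form, so the
argument
distinguishes B from B̃ as Tao demands, and no energy-class coercivity is claimed (odd functionals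
are not coercive;
use is one-sided, scale-invariant, Type-I only). LeraySelfSimilarBlowupExclusion /
AxisymmetricTypeIExclusion /
CriticalNormBlowupNecessity: consistent scenario facts; #3 targets the general Type-I class they
leave open.

Novelty: Nearest prior art actually searched (2026-08-15, zbMATH via `lit search --source zbmath`, local
hybrid index, lit frontier/bridges NavierStokesRegularity; OpenAlex/arXiv/S2 rate-limited this
session, galaxy saturated — queries logged in NOTES.md):
(a) Morawetz/virial monotonicity: LinStrauss1978 (doi:10.1016/0022-1236(78)90073-3),
CollianderEtAl2004 interaction Morawetz (doi:10.1002/cpa.20029); the ONLY fluid Morawetz in print is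
for gravity-capillary water waves, AlazardIfrimTataru2020 (doi:10.1007/s42286-020-00044-8,
arXiv:1910.02529) and arXiv:1806.08443 — a dispersive free-boundary model, nothing for bulk 3-D
Euler/NS ("Morawetz estimate incompressible Euler" → 1 hit = AIT; "virial identity incompressible
Euler monotone" → 0).
(b) SOS/auxiliary-functional certificates in fluids: ChernyshenkoEtAl2014
(doi:10.1098/rsta.2013.0350), FantuzziGoluskin2020 (doi:10.1137/19m1277953, arXiv:1907.10997) — SDP
searches for polynomial Lyapunov/bounding functionals of Galerkin truncations or of finitely many
global moments, never over local cubic DENSITIES with the exact pressure symbol.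
(c) Classification of local densities for Euler: Cheviakov–Oberlack JFM 760
(doi:10.1017/jfm.2014.611), Anco–Dar (doi:10.1098/rspa.2009.0072) — CONSERVED densities only; nobody
classifies densities by the SIGN of the Euler derivative.
(d) Order 3 / enstrophy production: Betchov 1956, Lu–Doering 2008, Q–R statistics
(Lüthi–Holzner–Tsinober doi:10.1017/s0022112009991947) — no sign theorem claimed.
(e) Con  [refs: 10.1016/0022-1236(78, 10.1002/cpa.20029, 10.1007/s42286-020-00044-8, 10.1098/rsta.2013.0350, 10.1137/19m1277953, 10.1017/jfm.2014.611, 10.1098/rspa.2009.0072, 10.1017/s0022112009991947, 10.1007/s00220-019-03566-6, 1910.02529, 1806.08443, 1907.10997, doi:10.1016/0022-1236, doi:10.1002/cpa.20029, doi:10.1007/s42286-020-00044-8, doi:10.1098/rsta.2013.0350, doi:10.1137/19m1277953, doi:10.1017/jfm.2014]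

Barriers (technique_class: odd-morawetz-functional sos-local-densities type-I-bridge): technique_class: odd-morawetz-functional sos-local-densities type-I-bridge
- Literature.Barriers.NavierStokesRegularity.TaoAveragedBlowup: a certificate "Q_M ≥ 0 on all
divergence-free Schwartz fields" is an algebraic positivity statement about the quartic form built
from the EXACT Euler bilinear operator B = Literature.Analysis.FluidPDE.eulerBilinear (pressure
symbol included); replacing B by an averaged B̃ changes the form and generically destroys the sign,
so the argument distinguishes B from B̃ as Tao's barrier demands. If instead the SDP returns
infeasibility at every order, that outcome is consistent with the barrier and is recorded as
negative knowledge (the odd half of the Lyapunov no-go).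
- Literature.Barriers.NavierStokesRegularity.TruncatedDyadicTypeIBlowup: crux #3 aims at Type-I
exclusion, which this facet blocks for energy-identity-plus-estimates arguments insensitive to
averaging/time-dependence of the nonlinearity; the bridge here runs on an exact identity d/dt M =
−Q_M + ν⟨M′,Δu⟩ specific to the autonomous Euler symbol (no Littlewood–Paley or function-space
estimate enters), so it falls outside the blocked class — the honest risk (why #3 might fail) is
quantitative (viscous term of the same order), not the barrier.
- Literature.Barriers.NavierStokesRegularity.EnergySupercriticality: not met — no coercive
energy-class quantity is used; odd functionals are not coercive at all; the use is one-sided and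
scale-invariant, confined to the Type-I (similarity-variable

Novelty grade: new-combination — ROUTE REVIEW (refuter, 2026-08-15). All 8 decls elaborate (Probe3 rc0). OBJECTIONS (fix before prover time): (1) stmt-1376 OddMorawetzLocal / stmt-1377 MorawetzKillsTypeI are MIS-TYPED via a Bochner loophole: M v := ∫ m(Jv) is 0 whenever m∘Jv is non-integrable, so any density with m(0) ≠ 0 (m = 1 +  (refuter refuter-rreview-route-NavierStokesRegula-42467265-0, 2026-08-15T12:17:41Z; prior: LinStrauss1978 / CollianderEtAl2004 (Morawetz, interaction Morawetz), AlazardIfrimTataru2020 (only fluid Morawetz in print, water waves), ChernyshenkoEtAl2014 / FantuzziGoluskin2020 (SOS auxiliary functionals), Betchov 1956 (tr A³ = 3 det A null Lagrangian; ∫tr S³ = −¾∫ω·Sω), Gavrilov GAFA 2019 (compactly supported steady Euler states — cheap falsifier, uncited), card morawetz-hunt-odd-virial (gra)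

History (route lifecycle, newest last):
- 2026-08-17T15:17:00Z · BROKEN — OddMorawetzLocal (stmt-NavierStokesRegularity-1376, crux) refuted by Summit.NavierStokesRegularity.NavierStokesRegularity.Theorems.not_OddMorawetzLocal @ 6d59d52ab46c (prover-line-stmt-NavierStokesRegularity-1376-c1-0)
- 2026-08-17T16:50:10Z · CLOSED refuted — refuted:stmt-NavierStokesRegularity-1376 (OddMorawetzLocal) by Summit.NavierStokesRegularity.NavierStokesRegularity.Theorems.not_OddMorawetzLocal (planner-rfix-NavierStokesRegularity-OddMoraw-9e6ccff7-0)

sub-problem: NavierStokesRegularity · status: closed(refuted) · opened planner-plancard-NavierStokesRegularity-Navie-e0bb6a2e-0 2026-08-15T10:55:09Z · rev 2 · ledger route-NavierStokesRegularity-OddMorawetz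
GENERATED by the gate from the ledger (D-0016/17). Provers cite these decls: `theorem foo : Summit.NavierStokesRegularity.NavierStokesRegularity.Theses.OddMorawetz.<Decl> := …` in Summits/NavierStokesRegularity/NavierStokesRegularity/Theorems/<Name>.lean.
-/

namespace Summit.NavierStokesRegularity.NavierStokesRegularity.Theses.OddMorawetz

open scoped BigOperators Topology Manifold Classical MeasureTheory ProbabilityTheory Matrix InnerProductSpace ComplexConjugate ContinuousMap
open Filter Set Function TopologicalSpace MeasureTheory

attribute [summit_statement] _root_.NavierStokesRegularity

open Literature.NS

/-- item stmt-NavierStokesRegularity-1217 · target · rank 0 · open · by planner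
why it might fail: ¬Target is a Type-I singularity from Schwartz data — open, and equivalent up to class bookkeeping to NontrivialTypeIAncientExists (AlbrittonBarker2019 Thm 1.1); DSS/Type-I scenarios remain 'completely open' (A–B §1), and every energy-identity+estimates proof is blocked (TruncatedDyadicTypeIBlowup).
sources: AlbrittonBarker2019, KNSS2009, SereginSverak2009, ChaeWolf2017RemovingDSS, Literature.Barriers.NavierStokesRegularity.TruncatedDyadicTypeIBlowup, Literature.Analysis.FluidPDE.NontrivialTypeIAncientExists
[target] X = NO TYPE-I BLOW-UP FOR CLAY DATA: a classical solution of unforced NS on ℝ³×[0,T) which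
is Leray–Hopf from a rapidly decaying datum and blows up at most at the Type-I rate ‖u(t)‖∞ ≤
C(T−t)^{-1/2} extends smoothly past T. Equals UnthreadedNoBlowup ∧ ThreadedNoBlowup by excluded
middle on 'every point is unthreaded' (proved in the planner's Sketch.lean: target_of_cruxes); it is
the unconditional conclusion of stmt-NavierStokesRegularity-0058 (route TypeILiouville, which
assumes (L)). With NoTypeII (stmt-0056) it gives NoBlowup (stmt-0054). Card:
threading-flux-trace-topology. -/
@[route_item "route-NavierStokesRegularity-OddMorawetz"]
def TypeIExclusion : Prop :=
  ∀ (ν T : ℝ), 0 < ν → 0 < T → ∀ (u : ℝ → EuclideanSpace ℝ (Fin 3) → EuclideanSpace ℝ (Fin 3)) (p : ℝ → EuclideanSpace ℝ (Fin 3) → ℝ), Literature.Analysis.FluidPDE.IsClassicalNSSolutionOn (Set.Ico 0 T) ν 0 u p → Literature.Analysis.FluidPDE.IsLerayHopfOn T ν 0 (u 0) u → Literature.Analysis.FluidPDE.HasRapidSpatialDecay (u 0) → Literature.Analysis.FluidPDE.IsTypeIBlowup u T → Literature.Analysis.FluidPDE.HasSmoothExtensionPast ν 0 u T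

/-- item stmt-NavierStokesRegularity-1376 · crux · rank 2 · closed · refuted by Summit.NavierStokesRegularity.NavierStokesRegularity.Theorems.not_OddMorawetzLocal @ 6d59d52ab46c (prover) · by planner
why it might fail: Likely infeasible: order 3 is 1-dim mod null Lagrangians (J≡−R) and Q_R=∫|Sω|²−∫ω·H_p·ω vanishes for planar flows, sign expected both ways; the order-5 SDP may return an infeasibility certificate. AS TYPED m(0)≠0 ⇒ M≡0 (Bochner) voids the (3,k) clause, so k=3,5 certificates cannot refute the item.
sources: LinStrauss1978, CollianderEtAl2004, AlazardIfrimTataru2020, ChernyshenkoEtAl2014, FantuzziGoluskin2020, doi:10.1017/jfm.2014.611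
[crux] THE HUNT (decidable order by order). ∃ k ≤ 5 and a smooth density m on 3-jets Ju(x) = (u, ∇u,
∇²u, ∇³u)(x) with M(u) = ∫ m(Ju) dx bi-homogeneous of degree (3,k) under u ↦ μ·u(s·) on div-free
Schwartz fields (an odd cubic local density of derivative order k; live cases k = 3, 5: k even, k =
1, pseudoscalar and even densities are conserved-or-unsigned by parity) whose EULER DERIVATIVE Q(u)
:= −∫ Dm(Ju)[J B(u,u)] dx (B = eulerBilinear = −P(u·∇u), pressure INCLUDED; Q = −dM/dt along ∂ₜu =
B(u,u)) is ≥ 0 on all div-free Schwartz fields and > 0 on one (Morawetz, not a first integral). WLOG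
isotropic, polynomial. Attack: isotropic cubic densities of order k mod null Lagrangians and div u =
0; Q as a quartic form with explicit symbol on {ξ₁+…+ξ₄ = 0}; SOS/SDP feasibility with exact
rational certificates (kit compute). Order 3 = span{R = ∫ω·Sω, J = ∫tr((∇u)²(∇u)ᵀ)} is the warm-up
(support OrderThreeIndefinite, expected negative). Refutation = infeasibility certificates at k = 3,
5 (explicit div-free test fields u_i, weights λ_i > 0 with Σλ_i Q_m(u_i) = 0 for all admissible m) =
'no local odd Morawetz functional of order ≤ 5 for 3-D Euler'. -/
@[route_item "route-NavierStokesRegularity-OddMorawetz", crux]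
def OddMorawetzLocal : Prop :=
  ∃ (k : ℕ) (m : EuclideanSpace ℝ (Fin 3) × (EuclideanSpace ℝ (Fin 3) [×1]→L[ℝ] EuclideanSpace ℝ (Fin 3)) × (EuclideanSpace ℝ (Fin 3) [×2]→L[ℝ] EuclideanSpace ℝ (Fin 3)) × (EuclideanSpace ℝ (Fin 3) [×3]→L[ℝ] EuclideanSpace ℝ (Fin 3)) → ℝ), let J := fun (v : EuclideanSpace ℝ (Fin 3) → EuclideanSpace ℝ (Fin 3)) (x : EuclideanSpace ℝ (Fin 3)) => (v x, iteratedFDeriv ℝ 1 v x, iteratedFDeriv ℝ 2 v x, iteratedFDeriv ℝ 3 v x); let Q := fun (v : EuclideanSpace ℝ (Fin 3) → EuclideanSpace ℝ (Fin 3)) => -∫ x, fderiv ℝ m (J v x) (J (Literature.Analysis.FluidPDE.eulerBilinear v v) x); k ≤ 5 ∧ ContDiff ℝ (⊤ : ℕ∞) m ∧ (∀ (μ : ℝ) z, m (μ • z) = μ ^ 3 * m z) ∧ (∀ (s : ℝ), 0 < s → ∀ (z₀ : EuclideanSpace ℝ (Fin 3)) (z₁ : EuclideanSpace ℝ (Fin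 3) [×1]→L[ℝ] EuclideanSpace ℝ (Fin 3)) (z₂ : EuclideanSpace ℝ (Fin 3) [×2]→L[ℝ] EuclideanSpace ℝ (Fin 3)) (z₃ : EuclideanSpace ℝ (Fin 3) [×3]→L[ℝ] EuclideanSpace ℝ (Fin 3)), m (z₀, s • z₁, (s ^ 2) • z₂, (s ^ 3) • z₃) = s ^ k * m (z₀, z₁, z₂, z₃)) ∧ (∀ v, Literature.Analysis.FluidPDE.IsSchwartzField v → Literature.Analysis.FluidPDE.VectorCalculus.IsDivFree v → 0 ≤ Q v) ∧ (∃ v, Literature.Analysis.FluidPDE.IsSchwartzField v ∧ Literature.Analysis.FluidPDE.VectorCalculus.IsDivFree v ∧ 0 < Q v)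

/-- item stmt-NavierStokesRegularity-1377 · crux · rank 3 · closed · vacuous by Summit.NavierStokesRegularity.NavierStokesRegularity.Theorems.MorawetzKillsTypeI_proof @ daf1c6732747 (prover) · by planner
why it might fail: Sign alone is Euler-level: on Type-I(C) ancient profiles ν⟨M′,ΔU⟩ (cubic, k+2 derivs) is of the order of Q_M at scale 1/C for all C; {Q_M=0} ⊇ planar fields, compact steady states (Gavrilov); M needs localising on non-decaying profiles. As typed ∀ covers non-homogeneous m (M≡0): no similarity tool.
sources: KNSS2009, SereginSverak2009, AlbrittonBarker2019, ChaeWolf2017RemovingDSS, Seregin2014Notes, ChaeWolf2020EulerTypeI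
[crux] THE BRIDGE. For every (k, m) as in OddMorawetzLocal (same lets; ∀-form, so the item is
logically (∃ certificate) → TypeIExclusion and closes vacuously if the hunt is negative), Type-I
blow-up of finite-energy classical solutions from rapidly decaying data is excluded. Mechanism:
along NS dM/dt = −Q + νV, V(u) = ∫Dm(Ju)[JΔu]; at a Type-I singular time pass to similarity
variables / the zoom-in limit (nontrivial bounded ancient mild solution with Type-I bounds,
SereginSverak2009 §§2–3, AlbrittonBarker2019 Thm 1.1); M has degree (3,k), so dm/ds = −Q(U) + νV(U)
− (k/2)M(U) for the normalised m(s) = M(U(s)); one-signed Q + control of {Q = 0} on the compact set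
of Type-I profiles puts α/ω-limits in {Q = 0}; rigidity there ⇒ U ≡ 0. PLANNER'S WARNING (why crux,
not support): the sign is NOT enough — on Type-I(C) profiles νV (cubic, k+2 derivatives) is of the
same order as Q (quartic, k+1) at the intrinsic length 1/C for every C, so the card's 'large-C
Liouville' fails as stated; needed: quantitative domination ν|V(U)| ≤ (1−δ)Q(U) on Type-I ancient
profiles, or rigidity of {Q = 0} ∩ {Type-I profiles} (e.g. 2-D ⇒ known Liouville facts), plus
localisation of M on non-decaying profiles. -/
@[route_item "route-NavierStokesRegularity-OddMorawetz", crux]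
def MorawetzKillsTypeI : Prop :=
  ∀ (k : ℕ) (m : EuclideanSpace ℝ (Fin 3) × (EuclideanSpace ℝ (Fin 3) [×1]→L[ℝ] EuclideanSpace ℝ (Fin 3)) × (EuclideanSpace ℝ (Fin 3) [×2]→L[ℝ] EuclideanSpace ℝ (Fin 3)) × (EuclideanSpace ℝ (Fin 3) [×3]→L[ℝ] EuclideanSpace ℝ (Fin 3)) → ℝ), let J := fun (v : EuclideanSpace ℝ (Fin 3) → EuclideanSpace ℝ (Fin 3)) (x : EuclideanSpace ℝ (Fin 3)) => (v x, iteratedFDeriv ℝ 1 v x, iteratedFDeriv ℝ 2 v x, iteratedFDeriv ℝ 3 v x); let Q := fun (v : EuclideanSpace ℝ (Fin 3) → EuclideanSpace ℝ (Fin 3)) => -∫ x, fderiv ℝ m (J v x) (J (Literature.Analysis.FluidPDE.eulerBilinear v v) x); k ≤ 5 → ContDiff ℝ (⊤ : ℕ∞) m → (∀ (μ : ℝ) z, m (μ • z) = μ ^ 3 * m z) → (∀ (s : ℝ), 0 < s → ∀ (z₀ : EuclideanSpace ℝ (Fin 3)) (z₁ : EuclideanSpace ℝ (Fin 3) [×1]→L[ℝ]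 EuclideanSpace ℝ (Fin 3)) (z₂ : EuclideanSpace ℝ (Fin 3) [×2]→L[ℝ] EuclideanSpace ℝ (Fin 3)) (z₃ : EuclideanSpace ℝ (Fin 3) [×3]→L[ℝ] EuclideanSpace ℝ (Fin 3)), m (z₀, s • z₁, (s ^ 2) • z₂, (s ^ 3) • z₃) = s ^ k * m (z₀, z₁, z₂, z₃)) → (∀ v, Literature.Analysis.FluidPDE.IsSchwartzField v → Literature.Analysis.FluidPDE.VectorCalculus.IsDivFree v → 0 ≤ Q v) → (∃ v, Literature.Analysis.FluidPDE.IsSchwartzField v ∧ Literature.Analysis.FluidPDE.VectorCalculus.IsDivFree v ∧ 0 < Q v) → ∀ (ν T : ℝ), 0 < ν → 0 < T → ∀ (u : ℝ → EuclideanSpace ℝ (Fin 3) → EuclideanSpace ℝ (Fin 3)) (p : ℝ → EuclideanSpace ℝ (Fin 3) → ℝ), Literature.Analysis.FluidPDE.IsClassicalNSSolutionOn (Set.Ico 0 T) ν 0 u p → Literature.Analysis.FluidPDE.IsLerayHopfOn T ν 0 (u 0) u → Literature.Analysis.FluidPDE.HasRapidSpatialDecay (u 0) → Literature.Analysis.FluidPDE.IsTypeIBlowup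 u T → Literature.Analysis.FluidPDE.HasSmoothExtensionPast ν 0 u T

/-- item stmt-NavierStokesRegularity-0056 · crux · rank 4 · open · by planner
why it might fail: No theorem bounds a blow-up rate from above (only special Type II scenarios excluded: Seregin arXiv:2606.29468 Thm 2.1); Tao's averaged-NS blow-up is Type II (arXiv:1402.0290 p.8 fn.), so abstract methods cannot prove it; Hou's axisymmetric candidate (arXiv:2107.06509), if real, refutes it (¬Clay A)
sources: Tao2016AveragedNS, KNSS2009, Seregin2012, Tao2021QuantitativeNS, arXiv:2107.06509, Hou2022PotentiallySingularNS
If a finite-energy classical solution from a rapidly decaying datum has maximal lifespan T<∞ (no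
classical extension past T), then ‖u(t)‖_∞ ≤ C (T−t)^{-1/2} eventually as t↑T (Leray's rate is the
matching lower bound, leray_blowup_rate_top). The hardest and most informative crux: a
counterexample is a Type II singularity, i.e. ¬(Clay A). Known: lower bound c√ν (T−t)^{-1/2} (Leray
1934 §20); L³ must blow up (ESS 2003, Seregin 2012); only triple-log quantitative gain (Tao 2021). -/
@[route_item "route-NavierStokesRegularity-OddMorawetz", crux]
def NoTypeII : Prop :=
  ∀ (ν T : ℝ), 0 < ν → 0 < T → ∀ (u : ℝ → EuclideanSpace ℝ (Fin 3) → EuclideanSpace ℝ (Fin 3)) (p : ℝ → EuclideanSpace ℝ (Fin 3) → ℝ), Literature.Analysis.FluidPDE.IsMaximalSmoothSolution ν 0 u p T → Literature.Analysis.FluidPDE.IsLerayHopfOn T ν 0 (u 0) u → Literature.Analysis.FluidPDE.HasRapidSpatialDecay (u 0) → Literature.Analysis.FluidPDE.IsTypeIBlowup u T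

/-- item stmt-NavierStokesRegularity-0055 · support · rank 9 · closed · proved by Summit.NavierStokesRegularity.NavierStokesRegularity.Theorems.typeICertificateLadder_noBlowupToClay_proof @ f501e9774e4d (prover) · by planner
sources: Leray1934, KNSS2009
Given NoBlowup, build the Clay (A) solution: local finite-energy classical solution for smooth
divergence-free rapidly decaying data (Leray 1934 §III / Fujita–Kato 1964 + LPS smoothing), continue
past every T using NoBlowup, glue by weak–strong uniqueness (Prodi–Serrin), bounded energy from the
energy inequality, and convert with
Literature.Analysis.FluidPDE.isNavierStokesSolution_and_smooth_iff. Blow-up at spatial infinity is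
excluded by CKN ε-regularity applied far out. May take named Literature facts (leray_existence_R3,
ladyzhenskaya_prodi_serrin, weak_strong_uniqueness, fujita_kato_local) as hypotheses if the grounder
so rules. -/
@[route_item "route-NavierStokesRegularity-OddMorawetz", crux]
def NoBlowupToClay : Prop :=
  (∀ (ν T : ℝ), 0 < ν → 0 < T → ∀ (u : ℝ → EuclideanSpace ℝ (Fin 3) → EuclideanSpace ℝ (Fin 3)) (p : ℝ → EuclideanSpace ℝ (Fin 3) → ℝ), Literature.Analysis.FluidPDE.IsClassicalNSSolutionOn (Set.Ico 0 T) ν 0 u p → Literature.Analysis.FluidPDE.IsLerayHopfOn T ν 0 (u 0) u → Literature.Analysis.FluidPDE.HasRapidSpatialDecay (u 0) → Literature.Analysis.FluidPDE.HasSmoothExtensionPast ν 0 u T) → NavierStokesRegularity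

/-- `NoBlowupToClay` holds: proved by `Summit.NavierStokesRegularity.NavierStokesRegularity.Theorems.typeICertificateLadder_noBlowupToClay_proof` @ f501e9774e4d. -/
theorem NoBlowupToClay_holds : NoBlowupToClay := _root_.Summit.NavierStokesRegularity.NavierStokesRegularity.Theorems.typeICertificateLadder_noBlowupToClay_proof

/-- item stmt-NavierStokesRegularity-1378 · support · rank 9 · closed · proved by Summit.NavierStokesRegularity.NavierStokesRegularity.Theorems.oddMorawetz_oddNoGoNS_proof (prover) · by planner
sources: Summits/NavierStokesRegularity/NavierStokesRegularity/Ideas/morawetz-hunt-odd-virial.md, Summits/NavierStokesRegularity/NavierStokesRegularity/Ideas/no-strict-even-lyapunov.md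
[support] Odd half of the Lyapunov no-go (completes the parity classification of card
no-strict-even-lyapunov; provable now). For ν > 0 and a smooth density m on 3-jets that is a cubic
form (m(μz) = μ³m(z)), with Q as in OddMorawetzLocal and V(u) := ∫ Dm(Ju)[J Δu] dx (so d/dt M = νV −
Q along NS): if νV − Q ≤ 0 on all divergence-free Schwartz fields (M non-increasing to first order
along every NS flow through Schwartz data) then V ≡ 0 and Q ≥ 0 there. Proof: apply the hypothesis
to μu, use Q(μu) = μ⁴Q(u), V(μu) = μ³V(u) (J linear, Dm 2-homogeneous, B bilinear incl. the
Fourier-side Leray projector, Δ linear), divide by μ³ and let μ → 0±. Moral: viscosity sees odd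
functionals only through an odd form, so an NS-Lyapunov functional in the odd cubic local class must
be heat-neutral; the Morawetz sector is an EULER phenomenon used one-sidedly (Type-I setting), never
an NS-Lyapunov functional. (Second step, not in the statement: heat-neutral + continuity ⇒ M ≡ 0 on
Schwartz div-free fields.) -/
@[route_item "route-NavierStokesRegularity-OddMorawetz"]
def OddNoGoNS : Prop :=
  ∀ (ν : ℝ) (m : EuclideanSpace ℝ (Fin 3) × (EuclideanSpace ℝ (Fin 3) [×1]→L[ℝ] EuclideanSpace ℝ (Fin 3)) × (EuclideanSpace ℝ (Fin 3) [×2]→L[ℝ] EuclideanSpace ℝ (Fin 3)) × (EuclideanSpace ℝ (Fin 3) [×3]→L[ℝ] EuclideanSpace ℝ (Fin 3)) → ℝ), let J := fun (v : EuclideanSpace ℝ (Fin 3) → EuclideanSpace ℝ (Fin 3)) (x : EuclideanSpace ℝ (Fin 3)) => (v x, iteratedFDeriv ℝ 1 v x, iteratedFDeriv ℝ 2 v x, iteratedFDeriv ℝ 3 v x); let Q := fun (v : EuclideanSpace ℝ (Fin 3) → EuclideanSpace ℝ (Fin 3)) => -∫ x, fderiv ℝ m (J v x) (J (Literature.Analysis.FluidPDE.eulerBilinear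 v v) x); let V := fun (v : EuclideanSpace ℝ (Fin 3) → EuclideanSpace ℝ (Fin 3)) => ∫ x, fderiv ℝ m (J v x) (J (Laplacian.laplacian v) x); 0 < ν → ContDiff ℝ (⊤ : ℕ∞) m → (∀ (μ : ℝ) z, m (μ • z) = μ ^ 3 * m z) → (∀ v, Literature.Analysis.FluidPDE.IsSchwartzField v → Literature.Analysis.FluidPDE.VectorCalculus.IsDivFree v → ν * V v - Q v ≤ 0) → ∀ v, Literature.Analysis.FluidPDE.IsSchwartzField v → Literature.Analysis.FluidPDE.VectorCalculus.IsDivFree v → V v = 0 ∧ 0 ≤ Q v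

/-- item stmt-NavierStokesRegularity-1379 · support · rank 9 · closed · proved by Summit.NavierStokesRegularity.NavierStokesRegularity.Theorems.oddMorawetz_orderThreeIndefinite_proof @ e3935ba8a78b (prover) · by planner
sources: Summits/NavierStokesRegularity/NavierStokesRegularity/Ideas/morawetz-hunt-odd-virial.md, DoeringGibbon1995, doi:10.1017/s0022112009991947
[support] Order-3 run of the hunt (expected NEGATIVE; by hand or a 2-parameter SDP). R(u) = ∫⟪ω,
(∇u)ω⟫ = ∫ω·Sω (enstrophy production, Betchov 1956 / Lu–Doering 2008) and J(u) = ∫ tr(A A Aᵀ), A =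
∇u, span the order-3 odd local densities on divergence-free fields modulo null Lagrangians (card's
reduction: one-derivative cubics vanish, ∫tr A³ = 3∫det A = 0; grounder to confirm the span). With b
= B(u,u): QR = −∫(⟪curl b, A ω⟫ + ⟪ω, (∇b) ω⟫ + ⟪ω, A curl b⟫) and QJ = −∫ tr(A_b A Aᵀ + A A_b Aᵀ +
A A A_bᵀ) are their exact Euler derivatives (sign: Q = −dM/dt). Claim: for every (a,c) ≠ (0,0) some
divergence-free Schwartz field makes a·QR + c·QJ < 0 (hence, applying it to (−a,−c), every nonzero
member of the family takes both signs: no order-3 Morawetz functional). Known piece: dR/dt|_Euler =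
∫|Sω|² − ∫ω·H_p·ω vanishes on 2-D fields and is expected to take both signs (production grows from
zero for generic data, decays after peak). Cheapest route: 3–4 explicit fields (curls of
Gaussian×polynomial potentials) whose (QR, QJ) vectors positively span ℝ², evaluated in exact
arithmetic on the Fourier side. -/
@[route_item "route-NavierStokesRegularity-OddMorawetz"]
def OrderThreeIndefinite : Prop :=
  ∀ a : ℝ, a ≠ 0 → ∃ v : EuclideanSpace ℝ (Fin 3) → EuclideanSpace ℝ (Fin 3), Literature.Analysis.FluidPDE.IsSchwartzField v ∧ Literature.Analysis.FluidPDE.VectorCalculus.IsDivFree v ∧ (let b := Literature.Analysis.FluidPDE.eulerBilinear v v; let w := Literature.Analysis.FluidPDE.curl v; let wb := Literature.Analysis.FluidPDE.curl b; let QR : ℝ := -∫ x, (⟪wb x, fderiv ℝ v x (w x)⟫_ℝ + ⟪w x, fderiv ℝ b x (w x)⟫_ℝ + ⟪w x, fderiv ℝ v x (wb x)⟫_ℝ); a * QR < 0)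

/-- item stmt-NavierStokesRegularity-1380 · assembly · rank 1 · closed · proved by Summit.NavierStokesRegularity.NavierStokesRegularity.Theorems.oddMorawetz_assembly_proof (prover) · by planner
sources: KNSS2009
[assembly] Pure logic (checked rc0 in the planner's Sketch.lean): given OddMorawetzLocal,
MorawetzKillsTypeI, NoTypeII and NoBlowupToClay, prove NavierStokesRegularity — apply
NoBlowupToClay; for a classical Leray–Hopf solution on [0,T) from a rapidly decaying datum argue by
contradiction: no extension ⇒ IsMaximalSmoothSolution ⇒ (NoTypeII) IsTypeIBlowup u T ⇒
(MorawetzKillsTypeI applied to the witnesses of OddMorawetzLocal) HasSmoothExtensionPast,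
contradiction. -/
@[route_item "route-NavierStokesRegularity-OddMorawetz"]
def Assembly : Prop :=
  OddMorawetzLocal → MorawetzKillsTypeI → NoTypeII → NoBlowupToClay → NavierStokesRegularity

/-! D-0027 §2.1 — DECIDING THEOREM (planner-authored via `route open/edit --closes-file`; by planner-rbadge-NavierStokesRegularity-OddMoraw-9e6ccff7-g2-0 2026-08-15T16:14:25Z) — ARCHIVED: route closed (refuted) 2026-08-17T16:50:10Z; kept so importers keep building:
its hypotheses are this route's items and its conclusion the sub-problem Statement (glue_lint), and it elaborates with this file. -/

@[closes "route-NavierStokesRegularity-OddMorawetz"] theorem closes (hOdd : OddMorawetzLocal) (hKill : MorawetzKillsTypeI) (hII : NoTypeII)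
    (hClay : NoBlowupToClay) : NavierStokesRegularity := by
  -- NoBlowupToClay reduces Clay (A) to continuation past every finite T
  apply hClay
  intro ν T hν hT u p hcl hLH hdec
  by_contra hext
  -- no extension ⇒ maximal ⇒ Type I (NoTypeII)
  have hTI : Literature.Analysis.FluidPDE.IsTypeIBlowup u T :=
    hII ν T hν hT u p ⟨hcl, hext⟩ hLH hdec
  -- the Morawetz certificate (OddMorawetzLocal) fed to the bridge (MorawetzKillsTypeI)
  obtain ⟨k, m, hk, hsm, hhom, hbi, hQ, hpos⟩ := hOdd
  exact hext (hKill k m hk hsm hhom hbi hQ hpos ν T hν hT u p hcl hLH hdec hTI)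

end Summit.NavierStokesRegularity.NavierStokesRegularity.Theses.OddMorawetz
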